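import Literature.Algebra.EuclideanLattices.LLLAlgorithmTermination
import HarnessLib

/-!
# The LLL algorithm in integer arithmetic (de Weger / Cohen's integral LLL)

Trunk: Lattice; sibling of `LLLAlgorithm.lean` (LLL82 Fig. 1 as the step function
`Literature.Algebra.EuclideanLattices.lllStep`) on the way to the machine-level fact `lllReduce_polyTime`. A machine runs
LLL82's algorithm on *integers* only: following H. Cohen, *A Course in Computational Algebraic
Number Theory* (GTM 138, 1993), §2.6.3 and Algorithm 2.6.7 (integral LLL, after de Weger), the
Gram–Schmidt data is carried as the integers `dᵢ` (Gram determinants, `gramDet` of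
`LLLAlgorithmTermination.lean`) and `λᵢⱼ = d_{j+1} μᵢⱼ`, all decisions and the nearest
integers are computed from them, and the `λ` are obtained from the Gram matrix by an exact
integer recursion. This file defines these quantities and proves that the resulting integer
step function *is* `lllStep` on lattice bases:

* `gsPartial f l x` (`πₗ(x)`, partial Gram–Schmidt reduction), `gsNum f i j` (`λᵢⱼ`),
  `gsU f l i j` (`uₗ(i,j) = dₗ ⟪bᵢ, πₗ(bⱼ)⟫`, Cohen's variable `u`); the recurrence
  `dₗ uₗ₊₁ = dₗ₊₁ uₗ - λⱼₗ λᵢₗ` (`gramDet_mul_gsU_succ`), `u₀ = ⟪bᵢ,bⱼ⟫`, `uⱼ(i,j) = λᵢⱼ`,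
  `uᵢ(i,i) = dᵢ₊₁`; integrality of every `uₗ(i,j)` for integer vectors (`exists_gsU_eq_intCast`,
  by Cramer's rule / the adjugate: `gramDet_smul_sub_gsPartial`);
* the decisions in integers: `|μₖₗ| ≤ ½ ↔ 2|λₖₗ| ≤ d_{l+1}` (`abs_gsCoeff_le_half_iff`),
  `round μₖₗ = ⌊(2λ + d)/(2d)⌋` (`round_gsCoeff_eq`), the Lovász test with `δ = 3/4` as
  `3 dₖ² ≤ 4 (dₖ₊₁ dₖ₋₁ + λ²ₖ,ₖ₋₁)` (`lovaszTestAt_iff_int`), and the update of row `k` of `λ`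
  under `bₖ ← bₖ - c bₗ` (`gsNum_update_sub_smul_self`);
* `intGram`, `uRec`, `dRec` — the integer Gram matrix and Cohen's recursion as an integer
  function, with `uRec_cast_eq_gsU` (all divisions are exact; `dRec = d`, `uRec b j i j = λᵢⱼ`);
* `intSizeReduce`, `intSizeReduceFrom`, `intStep` — `RED(k,l)` and the whole pass in integer
  arithmetic, and **`intStep_eq_lllStep`**, `iterate_intStep_eq`: on linearly independent
  integer vectors the integer algorithm runs through exactly the states of LLL82 Fig. 1 (with
  `δ = 3/4`). A stack machine for `lllReduce_polyTime` thus only has to implement `intStep` on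
  lists of integers.

## References

* H. Cohen, *A Course in Computational Algebraic Number Theory*, GTM 138, Springer 1993, §2.6.3
  (integral Gram–Schmidt, the `dᵢ`, `λᵢⱼ`) and Algorithm 2.6.7 (integral LLL), pp. 92–94 of
  the held copy (`book:cohen1993-course-computational-algebraic-number-theory`).
* A. K. Lenstra, H. W. Lenstra Jr., L. Lovász, Math. Ann. 261 (1982), §1, (1.28)–(1.29) and the
  proof of Prop. 1.26 (the `dⱼ μᵢⱼ` and `dᵢ₋₁ b*ᵢ` are integral).
* M. R. Bremner, *Lattice Basis Reduction*, CRC Press 2011, Prop. 3.11 and §4.3.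
-/

noncomputable section

namespace Literature.Algebra.EuclideanLattices

open InnerProductSpace Function Submodule Finset
open scoped RealInnerProductSpace Matrix

section Partial

variable {E : Type*} [NormedAddCommGroup E] [InnerProductSpace ℝ E] {n : ℕ}

/-- Sums over a prefix type `Fin j` are sums over the initial segment `Iio j`. [folklore] -/
theorem sum_fin_castLE_eq_sum_Iio {M : Type*} [AddCommMonoid M] (j : Fin n) (g : Fin n → M) :
    ∑ l' : Fin j, g (Fin.castLE (le_of_lt j.isLt) l') = ∑ l ∈ Finset.Iio j, g l := by
  rw [← Finset.sum_image (f := g) (s := Finset.univ) (g := Fin.castLE (le_of_lt j.isLt))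
    (fun a _ b _ h => Fin.castLE_injective _ h)]
  congr 1
  ext l
  simp only [Finset.mem_image, Finset.mem_univ, true_and, Finset.mem_Iio]
  constructor
  · rintro ⟨a, rfl⟩; exact Fin.lt_def.2 (by simp)
  · intro h; exact ⟨⟨l, Fin.lt_def.1 h⟩, Fin.ext rfl⟩

/-- The partial Gram–Schmidt reduction of a vector `x` against the first `l` Gram–Schmidt
vectors: `πₗ(x) = x - ∑_{l'<l} (⟪x, b*ₗ'⟫/‖b*ₗ'‖²) b*ₗ'`, the component of `x` orthogonal to
`b₀, …, bₗ₋₁` (so `πⱼ(bⱼ) = b*ⱼ`); the intermediate vectors of the Gram–Schmidt process as run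
incrementally (Cohen 1993, Algorithms 2.6.3/2.6.7). [cite: Cohen1993, Algorithm 2.6.7 (derivation, §2.6.3)] -/
def gsPartial (f : Fin n → E) (l : ℕ) (hl : l ≤ n) (x : E) : E :=
  x - ∑ l' : Fin l, (⟪x, gramSchmidt ℝ f (Fin.castLE hl l')⟫ /
    ‖gramSchmidt ℝ f (Fin.castLE hl l')‖ ^ 2) • gramSchmidt ℝ f (Fin.castLE hl l')

/-- `π₀(x) = x`. [folklore] -/
theorem gsPartial_zero (f : Fin n → E) (x : E) : gsPartial f 0 (Nat.zero_le n) x = x := by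
  simp [gsPartial]

/-- `πₗ₊₁(x) = πₗ(x) - (⟪x, b*ₗ⟫/‖b*ₗ‖²) b*ₗ`. [cite: Cohen1993, Algorithm 2.6.7 (derivation, §2.6.3)] -/
theorem gsPartial_succ (f : Fin n → E) (l : Fin n) (x : E) :
    gsPartial f (l + 1) l.isLt x = gsPartial f l (le_of_lt l.isLt) x -
      (⟪x, gramSchmidt ℝ f l⟫ / ‖gramSchmidt ℝ f l‖ ^ 2) • gramSchmidt ℝ f l := by
  simp only [gsPartial, Fin.sum_univ_castSucc]
  have e1 : Fin.castLE l.isLt (Fin.last l) = l := Fin.ext rfl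
  have e2 : ∀ l' : Fin l, Fin.castLE l.isLt l'.castSucc = Fin.castLE (le_of_lt l.isLt) l' :=
    fun l' => Fin.ext rfl
  simp only [e1, e2]
  abel

/-- `πⱼ(bⱼ) = b*ⱼ`. [folklore] -/
theorem gsPartial_self (f : Fin n → E) (j : Fin n) :
    gsPartial f j (le_of_lt j.isLt) (f j) = gramSchmidt ℝ f j := by
  rw [gsPartial, sum_fin_castLE_eq_sum_Iio j
    (fun l => (⟪f j, gramSchmidt ℝ f l⟫ / ‖gramSchmidt ℝ f l‖ ^ 2) • gramSchmidt ℝ f l)]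
  conv_lhs => arg 1; rw [self_eq_gramSchmidt_add_sum f j]
  simp only [gsCoeff, add_sub_cancel_right]

/-- `⟪πₗ(x), b*ₗ⟫ = ⟪x, b*ₗ⟫` (the subtracted `b*ₗ'`, `l' < l`, are orthogonal to `b*ₗ`).
[folklore] -/
theorem inner_gsPartial_gramSchmidt (f : Fin n → E) (l : Fin n) (x : E) :
    ⟪gsPartial f l (le_of_lt l.isLt) x, gramSchmidt ℝ f l⟫ = ⟪x, gramSchmidt ℝ f l⟫ := by
  rw [gsPartial, inner_sub_left, sum_inner, Finset.sum_eq_zero, sub_zero]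
  intro l' _
  rw [real_inner_smul_left, gramSchmidt_orthogonal ℝ f, mul_zero]
  exact fun h => by have := congrArg Fin.val h; simp at this; omega

/-- `x - πₗ(x)` lies in the span of `b₀, …, bₗ₋₁`. [folklore] -/
theorem sub_gsPartial_mem_span (f : Fin n → E) (l : ℕ) (hl : l ≤ n) (x : E) :
    x - gsPartial f l hl x ∈ span ℝ (Set.range (f ∘ Fin.castLE hl)) := by
  rw [gsPartial, sub_sub_cancel]
  refine Submodule.sum_mem _ fun l' _ => smul_mem _ _ ?_
  have h1 : gramSchmidt ℝ f (Fin.castLE hl l') ∈ span ℝ (f '' Set.Iic (Fin.castLE hl l')) :=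
    gramSchmidt_mem_span ℝ f le_rfl
  refine span_mono ?_ h1
  rintro _ ⟨i, hi, rfl⟩
  have hi' : (i : ℕ) < l := lt_of_le_of_lt (Fin.le_def.1 hi) (by simp)
  exact ⟨⟨i, hi'⟩, by simp [comp_apply]⟩

/-- `πₗ(x)` is orthogonal to `b₀, …, bₗ₋₁`. [folklore] -/
theorem inner_gsPartial_eq_zero (f : Fin n → E) (l : ℕ) (hl : l ≤ n) (x : E) (i : Fin l) :
    ⟪f (Fin.castLE hl i), gsPartial f l hl x⟫ = 0 := by
  -- `f (castLE i)` is in the span of the `b*ₗ'`, `l' ≤ i < l`, each orthogonal to `πₗ(x)`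
  have hmem : f (Fin.castLE hl i) ∈ span ℝ (Set.range fun l' : Fin l => gramSchmidt ℝ f (Fin.castLE hl l')) := by
    have h1 : f (Fin.castLE hl i) ∈ span ℝ (gramSchmidt ℝ f '' Set.Iic (Fin.castLE hl i)) := by
      rw [span_gramSchmidt_Iic]; exact subset_span ⟨_, Set.mem_Iic.2 le_rfl, rfl⟩
    refine span_mono ?_ h1
    rintro _ ⟨i', hi', rfl⟩
    have : (i' : ℕ) < l := lt_of_le_of_lt (Fin.le_def.1 hi') (by simp)
    exact ⟨⟨i', this⟩, by simp⟩
  have horth : ∀ l' : Fin l, ⟪gramSchmidt ℝ f (Fin.castLE hl l'), gsPartial f l hl x⟫ = 0 := by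
    intro l'
    rw [gsPartial, inner_sub_right, inner_sum]
    rw [Finset.sum_eq_single l']
    · rw [real_inner_smul_right, real_inner_self_eq_norm_sq, real_inner_comm]
      by_cases h0 : gramSchmidt ℝ f (Fin.castLE hl l') = 0
      · simp [h0]
      · rw [div_mul_cancel₀ _ (pow_ne_zero _ (norm_ne_zero_iff.2 h0)), sub_self]
    · intro l'' _ hne
      rw [real_inner_smul_right, gramSchmidt_orthogonal ℝ f, mul_zero]
      exact fun h => hne (Fin.castLE_injective _ h).symm
    · simp
  have key : ∀ y ∈ span ℝ (Set.range fun l' : Fin l => gramSchmidt ℝ f (Fin.castLE hl l')),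
      ⟪y, gsPartial f l hl x⟫ = 0 := by
    intro y hy
    induction hy using Submodule.span_induction with
    | mem y hy => obtain ⟨l', rfl⟩ := hy; exact horth l'
    | zero => exact inner_zero_left _
    | add y z _ _ hy hz => rw [inner_add_left, hy, hz, add_zero]
    | smul c y _ hy => rw [real_inner_smul_left, hy, mul_zero]
  exact key _ hmem

end Partial

/-! ### The integral quantities -/

section Quantities

variable {E : Type*} [NormedAddCommGroup E] [InnerProductSpace ℝ E] {n : ℕ}

/-- The numerators `λᵢⱼ = dⱼ ⟪bᵢ, b*ⱼ⟫ = d_{j+1} μᵢⱼ` of the Gram–Schmidt coefficients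
(integers for integer vectors; Cohen 1993, §2.6.3 and Algorithm 2.6.7; LLL82 (1.28)–(1.29)).
[cite: Cohen1993, Algorithm 2.6.7] [cite: LenstraLenstraLovasz1982, §1 (proof of Prop. 1.26)] -/
def gsNum (f : Fin n → E) (i j : Fin n) : ℝ :=
  gramDet f j (le_of_lt j.isLt) * ⟪f i, gramSchmidt ℝ f j⟫

/-- The intermediate quantities of the incremental computation of the `λᵢⱼ`:
`uₗ(i, j) = dₗ ⟪bᵢ, πₗ(bⱼ)⟫` (Cohen 1993, Algorithm 2.6.7, the variable `u`).
[cite: Cohen1993, Algorithm 2.6.7] -/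
def gsU (f : Fin n → E) (l : ℕ) (hl : l ≤ n) (i j : Fin n) : ℝ :=
  gramDet f l hl * ⟪f i, gsPartial f l hl (f j)⟫

/-- `λᵢⱼ = d_{j+1} μᵢⱼ`. [cite: Cohen1993, Algorithm 2.6.7] -/
theorem gsNum_eq_gramDet_succ_mul_gsCoeff (f : Fin n → E) (i j : Fin n) :
    gsNum f i j = gramDet f (j + 1) j.isLt * gsCoeff f i j := by
  rw [gsNum, gramDet_succ, gsCoeff, mul_assoc]
  congr 1
  by_cases h0 : gramSchmidt ℝ f j = 0
  · simp [h0]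
  · rw [mul_div_cancel₀ _ (pow_ne_zero _ (norm_ne_zero_iff.2 h0))]

/-- `u₀(i, j) = ⟪bᵢ, bⱼ⟫` (`d₀ = 1`, `π₀ = id`). [cite: Cohen1993, Algorithm 2.6.7] -/
theorem gsU_zero (f : Fin n → E) (i j : Fin n) : gsU f 0 (Nat.zero_le n) i j = ⟪f i, f j⟫ := by
  rw [gsU, gramDet_zero, gsPartial_zero, one_mul]

/-- `uⱼ(i, j) = λᵢⱼ`. [cite: Cohen1993, Algorithm 2.6.7] -/
theorem gsU_self_right (f : Fin n → E) (i j : Fin n) :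
    gsU f j (le_of_lt j.isLt) i j = gsNum f i j := by
  rw [gsU, gsPartial_self, gsNum]

/-- `uᵢ(i, i) = d_{i+1}`. [cite: Cohen1993, Algorithm 2.6.7] -/
theorem gsU_self (f : Fin n → E) (i : Fin n) : gsU f i (le_of_lt i.isLt) i i = gramDet f (i + 1) i.isLt := by
  rw [gsU, gsPartial_self, inner_self_gramSchmidt, gramDet_succ]

/-- **The recurrence of the integral Gram–Schmidt process** (Cohen 1993, Corollary 2.6.6 and
Algorithm 2.6.7, Step 2 [Incremental Gram–Schmidt]: `u := (d_{l+1} u - λⱼₗ λᵢₗ)/dₗ`),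
division-free form: `dₗ · uₗ₊₁(i, j) = dₗ₊₁ · uₗ(i, j) - λⱼₗ λᵢₗ`.
[cite: Cohen1993, Cor. 2.6.6 and Algorithm 2.6.7 Step 2] -/
theorem gramDet_mul_gsU_succ (f : Fin n → E) (l i j : Fin n) :
    gramDet f l (le_of_lt l.isLt) * gsU f (l + 1) l.isLt i j =
      gramDet f (l + 1) l.isLt * gsU f l (le_of_lt l.isLt) i j - gsNum f j l * gsNum f i l := by
  simp only [gsU, gsNum, gsPartial_succ, inner_sub_right, real_inner_smul_right, gramDet_succ]
  by_cases h0 : gramSchmidt ℝ f l = 0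
  · simp [h0]
  · have hpos : ‖gramSchmidt ℝ f l‖ ^ 2 ≠ 0 := pow_ne_zero _ (norm_ne_zero_iff.2 h0)
    field_simp

end Quantities

/-! ### Integrality for integer vectors -/

section Integral

variable {E : Type*} [NormedAddCommGroup E] [InnerProductSpace ℝ E] {n : ℕ}

/-- **Cramer/adjugate form of the partial Gram–Schmidt reduction.** `dₗ (x - πₗ(x))` is the
combination of `b₀, …, bₗ₋₁` with coefficient vector `adj(Gₗ) · (⟪bₗ', x⟫)ₗ'`, where `Gₗ` is the
Gram matrix of the first `l` vectors (so these coefficients are integers when all inner products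
are). [cite: Cohen1993, Prop. 2.6.5 (proof of (1))] [cite: Bremner2011, Prop. 3.11] -/
theorem gramDet_smul_sub_gsPartial (f : Fin n → E) (l : ℕ) (hl : l ≤ n) (x : E) :
    gramDet f l hl • (x - gsPartial f l hl x) =
      ∑ l' : Fin l, ((Matrix.gram ℝ (f ∘ Fin.castLE hl)).adjugate *ᵥ
        (fun l'' => ⟪(f ∘ Fin.castLE hl) l'', x⟫)) l' • (f ∘ Fin.castLE hl) l' := by
  set g := f ∘ Fin.castLE hl with hg
  set G := Matrix.gram ℝ g with hG
  obtain ⟨c, hc⟩ := (Submodule.mem_span_range_iff_exists_fun ℝ).1 (sub_gsPartial_mem_span f l hl x)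
  -- `G c = rhs`
  have hGc : G *ᵥ c = fun l'' => ⟪g l'', x⟫ := by
    funext l''
    rw [Matrix.mulVec, dotProduct]
    have h1 : ⟪g l'', x - gsPartial f l hl x⟫ = ⟪g l'', x⟫ := by
      rw [inner_sub_right, hg, comp_apply, inner_gsPartial_eq_zero, sub_zero]
    rw [← h1, ← hc, inner_sum]
    refine Finset.sum_congr rfl fun l' _ => ?_
    rw [hG, Matrix.gram_apply, real_inner_smul_right, mul_comm]
  have hadj : G.det • c = G.adjugate *ᵥ fun l'' => ⟪g l'', x⟫ := by
    rw [← hGc, Matrix.mulVec_mulVec, Matrix.adjugate_mul, Matrix.smul_mulVec, Matrix.one_mulVec]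
  rw [← hc, Finset.smul_sum]
  refine Finset.sum_congr rfl fun l' _ => ?_
  have h1 := congrFun hadj l'
  simp only [Pi.smul_apply, smul_eq_mul] at h1
  rw [smul_smul, show gramDet f l hl = G.det from rfl, h1]

variable {m : ℕ}

/-- For integer vectors, every `uₗ(i, j) = dₗ ⟪bᵢ, πₗ(bⱼ)⟫` is an integer.
[cite: Cohen1993, Cor. 2.6.6] [cite: LenstraLenstraLovasz1982, §1 (1.28)–(1.29)] -/
theorem exists_gsU_eq_intCast (b : Fin n → (Fin m → ℤ)) (l : ℕ) (hl : l ≤ n) (i j : Fin n) :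
    ∃ z : ℤ, gsU (⇑(intVecToEuclidean m).toAddMonoidHom ∘ b) l hl i j = z := by
  set f := ⇑(intVecToEuclidean m).toAddMonoidHom ∘ b with hf
  -- `u = d_l ⟪f i, f j⟫ - ⟪f i, d_l (f j - π_l f j)⟫`
  have e : gsU f l hl i j = gramDet f l hl * ⟪f i, f j⟫ - ⟪f i, gramDet f l hl • (f j - gsPartial f l hl (f j))⟫ := by
    rw [gsU, real_inner_smul_right, inner_sub_right, mul_sub]; ring
  rw [e, gramDet_smul_sub_gsPartial, inner_sum]
  -- every term is an integer
  obtain ⟨d, hd⟩ := exists_gramDet_eq_intCast b l hl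
  have hinner : ∀ v w : Fin m → ℤ, ⟪intVecToEuclidean m v, intVecToEuclidean m w⟫ = ((∑ t, v t * w t : ℤ) : ℝ) := by
    intro v w
    simp only [PiLp.inner_apply, intVecToEuclidean_apply, RCLike.inner_apply, conj_trivial, Int.cast_sum,
      Int.cast_mul]
    exact Finset.sum_congr rfl fun t _ => mul_comm _ _
  set Gz : Matrix (Fin l) (Fin l) ℤ := Matrix.of fun a c => ∑ t, b (Fin.castLE hl a) t * b (Fin.castLE hl c) t with hGz
  have hG : Matrix.gram ℝ (f ∘ Fin.castLE hl) = Gz.map (Int.cast : ℤ → ℝ) := by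
    rw [show f ∘ Fin.castLE hl = fun a => intVecToEuclidean m (b (Fin.castLE hl a)) from rfl,
      gram_intVecToEuclidean]
  set rz : Fin l → ℤ := fun a => ∑ t, b (Fin.castLE hl a) t * b j t with hrz
  have hr : (fun l'' => ⟪(f ∘ Fin.castLE hl) l'', f j⟫) = fun a => ((rz a : ℤ) : ℝ) := by
    funext a; exact hinner _ _
  have hadj : (Matrix.gram ℝ (f ∘ Fin.castLE hl)).adjugate *ᵥ (fun l'' => ⟪(f ∘ Fin.castLE hl) l'', f j⟫) =
      fun a => (((Gz.adjugate *ᵥ rz) a : ℤ) : ℝ) := by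
    rw [hG, hr, show Gz.map (Int.cast : ℤ → ℝ) = (Int.castRingHom ℝ).mapMatrix Gz from rfl,
      ← RingHom.map_adjugate]
    funext a
    simp [Matrix.mulVec, dotProduct, Matrix.map_apply]
  have hfi : ∀ i j : Fin n, ⟪f i, f j⟫ = ((∑ t, b i t * b j t : ℤ) : ℝ) := fun i j => hinner _ _
  have hfa : ∀ (i : Fin n) (a : Fin l), ⟪f i, (f ∘ Fin.castLE hl) a⟫ =
      ((∑ t, b i t * b (Fin.castLE hl a) t : ℤ) : ℝ) := fun i a => hinner _ _
  refine ⟨d * (∑ t, b i t * b j t) - ∑ a, (Gz.adjugate *ᵥ rz) a * ∑ t, b i t * b (Fin.castLE hl a) t, ?_⟩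
  rw [hadj, hd]
  simp only [real_inner_smul_right, hfi, hfa]
  push_cast
  ring

/-- In particular the `λᵢⱼ` of integer vectors are integers.
[cite: Cohen1993, Algorithm 2.6.7] [cite: LenstraLenstraLovasz1982, §1 (1.29)] -/
theorem exists_gsNum_eq_intCast (b : Fin n → (Fin m → ℤ)) (i j : Fin n) :
    ∃ z : ℤ, gsNum (⇑(intVecToEuclidean m).toAddMonoidHom ∘ b) i j = z := by
  rw [← gsU_self_right]; exact exists_gsU_eq_intCast b j _ i j

end Integral

section Decisions

variable {E : Type*} [NormedAddCommGroup E] [InnerProductSpace ℝ E] {n : ℕ}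

/-- `λₗₗ = d_{l+1}`. [cite: Cohen1993, Algorithm 2.6.7] -/
theorem gsNum_self (f : Fin n → E) (l : Fin n) : gsNum f l l = gramDet f (l + 1) l.isLt := by
  rw [gsNum, inner_self_gramSchmidt, gramDet_succ]

/-- `λₗⱼ = 0` for `l < j`. [cite: Cohen1993, Algorithm 2.6.7] -/
theorem gsNum_eq_zero_of_lt (f : Fin n → E) {l j : Fin n} (h : l < j) : gsNum f l j = 0 := by
  rw [gsNum, real_inner_comm, gramSchmidt_inv_triangular ℝ f h, mul_zero]

/-- **Size-reduction test in integers**: for `d_{l+1} > 0`,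
`|μₖₗ| ≤ 1/2 ↔ 2|λₖₗ| ≤ d_{l+1}`. [cite: Cohen1993, Algorithm 2.6.7 (Sub-algorithm REDI(k,l))] -/
theorem abs_gsCoeff_le_half_iff (f : Fin n → E) (k l : Fin n) (hd : 0 < gramDet f (l + 1) l.isLt) :
    |gsCoeff f k l| ≤ 1 / 2 ↔ 2 * |gsNum f k l| ≤ gramDet f (l + 1) l.isLt := by
  rw [gsNum_eq_gramDet_succ_mul_gsCoeff, abs_mul, abs_of_pos hd]
  constructor
  · intro h; nlinarith
  · intro h; nlinarith

/-- Floor of a quotient of integers, computed in `ℝ`, is integer division. [folklore] -/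
theorem floor_intCast_div_intCast (a : ℤ) {b : ℤ} (hb : 0 < b) : ⌊(a : ℝ) / (b : ℝ)⌋ = a / b := by
  rw [Int.floor_div_cast_of_nonneg hb.le, Int.floor_intCast]

/-- **The nearest integer in integers**: if `λₖₗ = z` and `d_{l+1} = D > 0` are integers then
`round μₖₗ = ⌊(2z + D) / (2D)⌋` (integer division). [cite: Cohen1993, Algorithm 2.6.7 (Sub-algorithm REDI(k,l))] -/
theorem round_gsCoeff_eq (f : Fin n → E) (k l : Fin n) {z D : ℤ} (hz : gsNum f k l = z)
    (hD : gramDet f (l + 1) l.isLt = D) (hDpos : 0 < D) :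
    round (gsCoeff f k l) = (2 * z + D) / (2 * D) := by
  have hμ : gsCoeff f k l = (z : ℝ) / D := by
    have h := gsNum_eq_gramDet_succ_mul_gsCoeff f k l
    rw [hz, hD] at h
    have hD' : (D : ℝ) ≠ 0 := by exact_mod_cast hDpos.ne'
    field_simp; linarith
  rw [round_eq, hμ, ← floor_intCast_div_intCast (2 * z + D) (by omega : (0 : ℤ) < 2 * D)]
  congr 1
  have hD' : (D : ℝ) ≠ 0 := by exact_mod_cast hDpos.ne'
  push_cast
  field_simp

/-- **The Lovász test in integers** (δ = 3/4): for `1 ≤ k` with `dₖ₋₁ > 0` and `b*ₖ₋₁ ≠ 0`,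
`¾ ‖b*ₖ₋₁‖² ≤ ‖b*ₖ + μ b*ₖ₋₁‖² ↔ 3 dₖ² ≤ 4 (dₖ₊₁ dₖ₋₁ + λₖ,ₖ₋₁²)`.
[cite: Cohen1993, Algorithm 2.6.7 (Step 3, integral Lovász condition)] -/
theorem lovaszTestAt_iff_int (f : Fin n → E) (j k : Fin n) (hjk : (k : ℕ) = j + 1)
    (hdj : 0 < gramDet f j (le_of_lt j.isLt)) (hGSj : gramSchmidt ℝ f j ≠ 0) :
    LovaszTestAt (3 / 4) f j k ↔
      3 * gramDet f k (le_of_lt k.isLt) ^ 2 ≤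
        4 * (gramDet f (k + 1) k.isLt * gramDet f j (le_of_lt j.isLt) + gsNum f k j ^ 2) := by
  have hjk' : j < k := Fin.lt_def.2 (by omega)
  -- the quantities
  set a := ‖gramSchmidt ℝ f j‖ ^ 2 with ha
  set c := ‖gramSchmidt ℝ f k‖ ^ 2 with hc
  set μ := gsCoeff f k j with hμ
  set dj := gramDet f j (le_of_lt j.isLt) with hdj'
  have hapos : 0 < a := pow_pos (norm_pos_iff.2 hGSj) 2
  have hk : gramDet f k (le_of_lt k.isLt) = dj * a := by
    rw [gramDet_eq_of_eq f hjk (le_of_lt k.isLt) j.isLt, gramDet_succ]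
  have hk1 : gramDet f (k + 1) k.isLt = dj * a * c := by rw [gramDet_succ, hk]
  have hlam : gsNum f k j = dj * a * μ := by
    rw [gsNum_eq_gramDet_succ_mul_gsCoeff, ← gramDet_eq_of_eq f hjk (le_of_lt k.isLt) j.isLt, hk]
  -- expand the test
  have hexp : ‖gramSchmidt ℝ f k + gsCoeff f k j • gramSchmidt ℝ f j‖ ^ 2 = c + μ ^ 2 * a := by
    rw [← real_inner_self_eq_norm_sq, inner_add_left, inner_add_right, inner_add_right,
      real_inner_smul_left, real_inner_smul_right, real_inner_smul_left, real_inner_smul_right,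
      real_inner_self_eq_norm_sq, real_inner_self_eq_norm_sq, gramSchmidt_orthogonal ℝ f hjk'.ne',
      gramSchmidt_orthogonal ℝ f hjk'.ne]
    ring
  unfold LovaszTestAt
  rw [hexp, hk, hk1, hlam]
  have hpos : 0 < dj ^ 2 * a := by positivity
  constructor
  · intro h
    have := mul_le_mul_of_nonneg_left h hpos.le
    nlinarith
  · intro h
    by_contra hlt
    have hlt := not_le.1 hlt
    have := mul_lt_mul_of_pos_left hlt hpos
    nlinarith

/-- **The `λ` of row `k` after the row operation `bₖ ← bₖ - c • bₗ`** (`l < k`):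
`λ'ₖⱼ = λₖⱼ - c λₗⱼ` for every `j` (so `λ'ₖₗ = λₖₗ - c d_{l+1}` and `λ'ₖⱼ = λₖⱼ` for `j > l`);
the `dᵢ` and the other rows are unchanged. [cite: Cohen1993, Algorithm 2.6.7 (sub-algorithm RED)] -/
theorem gsNum_update_sub_smul_self (f : Fin n → E) {k l : Fin n} (hlk : l < k) (c : ℝ) (j : Fin n) :
    gsNum (update f k (f k - c • f l)) k j = gsNum f k j - c * gsNum f l j := by
  rw [gsNum_eq_gramDet_succ_mul_gsCoeff, gsNum_eq_gramDet_succ_mul_gsCoeff,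
    gsNum_eq_gramDet_succ_mul_gsCoeff, gsCoeff_update_sub_smul_self f hlk,
    gramDet_congr_of_gramSchmidt_eq (gramSchmidt_update_sub_smul f hlk c)]
  ring

/-- Rows `i ≠ k` keep their `λ` under `bₖ ← bₖ - c • bₗ`. [cite: Cohen1993, Algorithm 2.6.7 (sub-algorithm RED)] -/
theorem gsNum_update_sub_smul_of_ne (f : Fin n → E) {k l : Fin n} (hlk : l < k) (c : ℝ) {i : Fin n}
    (hi : i ≠ k) (j : Fin n) : gsNum (update f k (f k - c • f l)) i j = gsNum f i j := by
  rw [gsNum_eq_gramDet_succ_mul_gsCoeff, gsNum_eq_gramDet_succ_mul_gsCoeff,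
    gsCoeff_update_sub_smul_of_ne f hlk c hi,
    gramDet_congr_of_gramSchmidt_eq (gramSchmidt_update_sub_smul f hlk c)]

/-- The `dᵢ` are unchanged under `bₖ ← bₖ - c • bₗ`. [cite: Cohen1993, Algorithm 2.6.7 (sub-algorithm RED)] -/
theorem gramDet_update_sub_smul (f : Fin n → E) {k l : Fin n} (hlk : l < k) (c : ℝ) (i : ℕ) (hi : i ≤ n) :
    gramDet (update f k (f k - c • f l)) i hi = gramDet f i hi :=
  gramDet_congr_of_gramSchmidt_eq (gramSchmidt_update_sub_smul f hlk c) i hi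

end Decisions

section Recurrence

variable {n m : ℕ}

/-- The integer Gram matrix `Gᵢⱼ = ⟪bᵢ, bⱼ⟫ = ∑ₜ bᵢₜ bⱼₜ` of integer vectors (the input of
Cohen's Algorithm 2.6.7). [cite: Cohen1993, Algorithm 2.6.7 (input)] -/
def intGram (b : Fin n → (Fin m → ℤ)) (i j : Fin n) : ℤ := ∑ t, b i t * b j t

/-- **Cohen's integral Gram–Schmidt recurrence as an integer recursion**:
`u₀(i,j) = Gᵢⱼ`, `uₗ₊₁(i,j) = (uₗ(l,l) · uₗ(i,j) - uₗ(j,l) · uₗ(i,l)) / dₗ` with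
`d₀ = 1`, `dₗ = uₗ₋₁(l-1,l-1)` (integer division, exact on lattice bases). Here `uₗ(i,j)`
stands for `dₗ ⟪bᵢ, πₗ(bⱼ)⟫` (`gsU`), so `uⱼ(i,j) = λᵢⱼ` and `uᵢ(i,i) = dᵢ₊₁`
(`uRec_cast_eq_gsU`). Junk value `0` beyond `l = n`.
[cite: Cohen1993, Cor. 2.6.6 and Algorithm 2.6.7 Step 2] -/
def uRec (b : Fin n → (Fin m → ℤ)) : ℕ → Fin n → Fin n → ℤ
  | 0, i, j => intGram b i j
  | l + 1, i, j =>
    if h : l < n then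
      (uRec b l ⟨l, h⟩ ⟨l, h⟩ * uRec b l i j - uRec b l j ⟨l, h⟩ * uRec b l i ⟨l, h⟩) /
        (if l = 0 then 1 else uRec b (l - 1) ⟨l - 1, by omega⟩ ⟨l - 1, by omega⟩)
    else 0
termination_by l => l
decreasing_by all_goals omega

/-- The integer `dₗ` read off the recursion: `d₀ = 1`, `dₗ₊₁ = uₗ(l,l)`. [cite: Cohen1993, Algorithm 2.6.7] -/
def dRec (b : Fin n → (Fin m → ℤ)) : ℕ → ℤ
  | 0 => 1
  | l + 1 => if h : l < n then uRec b l ⟨l, h⟩ ⟨l, h⟩ else 0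

/-- Unfolding `uRec` at `0`. [folklore] -/
theorem uRec_zero (b : Fin n → (Fin m → ℤ)) (i j : Fin n) : uRec b 0 i j = intGram b i j := by
  rw [uRec]

/-- Unfolding `uRec` at a successor. [folklore] -/
theorem uRec_succ (b : Fin n → (Fin m → ℤ)) (l : Fin n) (i j : Fin n) :
    uRec b (l + 1) i j =
      (uRec b l l l * uRec b l i j - uRec b l j l * uRec b l i l) / dRec b l := by
  rw [uRec, dif_pos l.isLt]
  congr 1
  obtain ⟨lv, hlv⟩ := l
  cases lv with
  | zero => simp [dRec]
  | succ l' => simp [dRec, show l' < n by omega]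

/-- `Gᵢⱼ` is the inner product. [folklore] -/
theorem cast_intGram (b : Fin n → (Fin m → ℤ)) (i j : Fin n) :
    (intGram b i j : ℝ) = ⟪intVecToEuclidean m (b i), intVecToEuclidean m (b j)⟫ := by
  simp only [intGram, PiLp.inner_apply, intVecToEuclidean_apply, RCLike.inner_apply, conj_trivial,
    Int.cast_sum, Int.cast_mul]
  exact Finset.sum_congr rfl fun t _ => mul_comm _ _

/-- **Correctness of the integer recursion** (Cohen 1993, Algorithm 2.6.7): on linearly
independent integer vectors, `uₗ(i,j)` computed in integers is `dₗ ⟪bᵢ, πₗ(bⱼ)⟫`, for all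
`l ≤ n`; in particular all divisions are exact. [cite: Cohen1993, Algorithm 2.6.7] -/
theorem uRec_cast_eq_gsU (b : Fin n → (Fin m → ℤ))
    (hli : LinearIndependent ℝ (⇑(intVecToEuclidean m).toAddMonoidHom ∘ b)) :
    ∀ (l : ℕ) (hl : l ≤ n) (i j : Fin n),
      (uRec b l i j : ℝ) = gsU (⇑(intVecToEuclidean m).toAddMonoidHom ∘ b) l hl i j := by
  set f := ⇑(intVecToEuclidean m).toAddMonoidHom ∘ b with hf
  intro l
  induction l using Nat.strong_induction_on with
  | _ l ih =>
    intro hl i j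
    obtain _ | l := l
    · rw [uRec_zero, cast_intGram, gsU_zero]; rfl
    have hln : l < n := hl
    set L : Fin n := ⟨l, hln⟩ with hL
    have ih' := ih l (Nat.lt_succ_self l) hln.le
    -- the denominator is `d_l ≥ 1`
    have hden : (dRec b l : ℝ) = gramDet f l hln.le := by
      obtain _ | l' := l
      · simp [dRec, gramDet_zero]
      · have h' : l' < n := by omega
        simp only [dRec, dif_pos h']
        rw [ih l' (by omega) (by omega) ⟨l', h'⟩ ⟨l', h'⟩]
        exact gsU_self f ⟨l', h'⟩
    obtain ⟨D, hD⟩ := exists_gramDet_eq_intCast b l hln.le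
    have hD1 : 1 ≤ D := by
      have := one_le_gramDet b hli l hln.le
      rw [hD] at this; exact_mod_cast this
    obtain ⟨z, hz⟩ := exists_gsU_eq_intCast b (l + 1) hl i j
    -- the numerator is `d_l · u_{l+1}`
    have hnum : ((uRec b l L L * uRec b l i j - uRec b l j L * uRec b l i L : ℤ) : ℝ) = D * z := by
      push_cast
      rw [ih' L L, ih' i j, ih' j L, ih' i L, gsU_self f L, gsU_self_right f j L,
        gsU_self_right f i L, ← hz, ← hD]
      have := gramDet_mul_gsU_succ f L i j
      rw [show gramDet f (↑L) (le_of_lt L.isLt) = gramDet f l hln.le from rfl] at this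
      linarith [this]
    have hdenZ : dRec b l = D := by exact_mod_cast hden.trans hD
    have hnumZ : uRec b l L L * uRec b l i j - uRec b l j L * uRec b l i L = D * z := by
      exact_mod_cast hnum
    have e1 : uRec b (l + 1) i j =
        (uRec b l L L * uRec b l i j - uRec b l j L * uRec b l i L) / dRec b l := uRec_succ b L i j
    rw [e1, hnumZ, hdenZ, Int.mul_ediv_cancel_left _ (by omega), ← hz]

/-- Consequently `dRec b l = dₗ` (`l ≤ n`). [cite: Cohen1993, Algorithm 2.6.7] -/
theorem dRec_cast_eq_gramDet (b : Fin n → (Fin m → ℤ))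
    (hli : LinearIndependent ℝ (⇑(intVecToEuclidean m).toAddMonoidHom ∘ b)) (l : ℕ) (hl : l ≤ n) :
    (dRec b l : ℝ) = gramDet (⇑(intVecToEuclidean m).toAddMonoidHom ∘ b) l hl := by
  obtain _ | l' := l
  · simp [dRec, gramDet_zero]
  · have h' : l' < n := by omega
    simp only [dRec, dif_pos h']
    rw [uRec_cast_eq_gsU b hli l' h'.le]
    exact gsU_self _ ⟨l', h'⟩

/-- And `uRec b j i j = λᵢⱼ`. [cite: Cohen1993, Algorithm 2.6.7] -/
theorem uRec_cast_eq_gsNum (b : Fin n → (Fin m → ℤ))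
    (hli : LinearIndependent ℝ (⇑(intVecToEuclidean m).toAddMonoidHom ∘ b)) (i j : Fin n) :
    (uRec b j i j : ℝ) = gsNum (⇑(intVecToEuclidean m).toAddMonoidHom ∘ b) i j := by
  rw [uRec_cast_eq_gsU b hli j (le_of_lt j.isLt), gsU_self_right]

end Recurrence

/-! ### The LLL pass in integer arithmetic -/

section IntStep

variable {n m : ℕ}

/-- `reduce(k, l)` in integer arithmetic (Cohen 1993, Algorithm 2.6.7, sub-algorithm RED):
with `λ = λₖₗ` and `d = d_{l+1}`, if `2|λ| ≤ d` do nothing, else `bₖ ← bₖ - q bₗ` with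
`q = ⌊(2λ + d) / (2d)⌋` (the nearest integer to `λ/d`, ties upward as Mathlib's `round`).
[cite: Cohen1993, Algorithm 2.6.7 (sub-algorithm RED)] -/
def intSizeReduce (b : Fin n → (Fin m → ℤ)) (k l : Fin n) : Fin n → (Fin m → ℤ) :=
  if 2 * |uRec b l k l| ≤ dRec b (l + 1) then b
  else update b k (b k - ((2 * uRec b l k l + dRec b (l + 1)) / (2 * dRec b (l + 1))) • b l)

/-- The descending integer size-reduction loop `RED(k, a-1), …, RED(k, 0)`. [cite: Cohen1993, Algorithm 2.6.7] -/
def intSizeReduceFrom (k : Fin n) : (a : ℕ) → a ≤ n → (Fin n → (Fin m → ℤ)) → (Fin n → (Fin m → ℤ))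
  | 0, _, b => b
  | a + 1, h, b => intSizeReduceFrom k a (Nat.le_of_succ_le h) (intSizeReduce b k ⟨a, h⟩)

/-- **One pass of LLL82 Fig. 1 in integer arithmetic** (de Weger's / Cohen's integral LLL,
Cohen 1993 Algorithm 2.6.7, with `δ = 3/4`): `RED(k, k-1)`; Lovász test
`3 dₖ² ≤ 4 (dₖ₊₁ dₖ₋₁ + λₖ,ₖ₋₁²)`; then `RED(k, k-2), …, RED(k, 0)` and `k + 1`, or exchange
and `max(1, k-1)`. All `dᵢ`, `λᵢⱼ` are those of the *current* family: `intStep` recomputes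
them from scratch via `uRec`/`dRec` (Cohen's algorithm maintains them incrementally instead; the
REDI update is `gsNum_update_sub_smul_self`, the exchange update SWAPI is not formalised here).
Equal to `lllStep _ (3/4)` on lattice bases (`intStep_eq_lllStep`).
[cite: Cohen1993, Algorithm 2.6.7] [cite: LenstraLenstraLovasz1982, §1 Fig. 1] -/
def intStep (s : LLLState n (Fin m → ℤ)) : LLLState n (Fin m → ℤ) :=
  if hk : 0 < s.k ∧ s.k < n then
    let k : Fin n := ⟨s.k, hk.2⟩
    let j : Fin n := ⟨s.k - 1, by omega⟩
    let b₁ : Fin n → (Fin m → ℤ) := intSizeReduce s.b k j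
    if 3 * dRec b₁ s.k ^ (2 : ℕ) ≤ 4 * (dRec b₁ (s.k + 1) * dRec b₁ (s.k - 1) + uRec b₁ (s.k - 1) k j ^ (2 : ℕ))
    then ⟨intSizeReduceFrom k (s.k - 1) (by omega) b₁, s.k + 1⟩
    else ⟨b₁ ∘ Equiv.swap j k, max 1 (s.k - 1)⟩
  else if s.k < n then ⟨s.b, 1⟩
  else s

/-- `RED(k, l) = reduce(k, l)` on linearly independent integer vectors (`l < k`).
[cite: Cohen1993, Algorithm 2.6.7 (sub-algorithm RED)] -/
theorem intSizeReduce_eq (b : Fin n → (Fin m → ℤ))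
    (hli : LinearIndependent ℝ (⇑(intVecToEuclidean m).toAddMonoidHom ∘ b)) (k l : Fin n) :
    intSizeReduce b k l = lllSizeReduce (intVecToEuclidean m).toAddMonoidHom b k l := by
  set φ := (intVecToEuclidean m).toAddMonoidHom with hφ
  set f := ⇑φ ∘ b with hf
  have hlam : (uRec b l k l : ℝ) = gsNum f k l := uRec_cast_eq_gsNum b hli k l
  have hd : (dRec b (l + 1) : ℝ) = gramDet f (l + 1) l.isLt := dRec_cast_eq_gramDet b hli (l + 1) l.isLt
  have hdpos : 0 < dRec b (l + 1) := by
    have := one_le_gramDet b hli (l + 1) l.isLt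
    rw [← hd] at this; exact_mod_cast this
  have htest : (2 * |uRec b l k l| ≤ dRec b (l + 1)) ↔ |gsCoeff f k l| ≤ 1 / 2 := by
    rw [abs_gsCoeff_le_half_iff f k l (by rw [← hd]; exact_mod_cast hdpos), ← hlam, ← hd]
    constructor
    · intro h; exact_mod_cast h
    · intro h; exact_mod_cast h
  unfold intSizeReduce lllSizeReduce
  by_cases h : 2 * |uRec b l k l| ≤ dRec b (l + 1)
  · rw [if_pos h, if_pos (htest.1 h)]
  · rw [if_neg h, if_neg (fun h' => h (htest.2 h'))]
    congr 2
    rw [round_gsCoeff_eq f k l hlam.symm hd.symm hdpos]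

/-- `RED` keeps linear independence. [folklore] -/
theorem linearIndependent_intSizeReduce (b : Fin n → (Fin m → ℤ))
    (hli : LinearIndependent ℝ (⇑(intVecToEuclidean m).toAddMonoidHom ∘ b)) {k l : Fin n}
    (hlk : l < k) :
    LinearIndependent ℝ (⇑(intVecToEuclidean m).toAddMonoidHom ∘ intSizeReduce b k l) := by
  rw [intSizeReduce_eq b hli]
  exact linearIndependent_of_gramSchmidt_eq (gramSchmidt_lllSizeReduce _ b hlk).symm hli

/-- The integer size-reduction loop is the real one on linearly independent integer vectors.
[cite: Cohen1993, Algorithm 2.6.7] -/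
theorem intSizeReduceFrom_eq (k : Fin n) :
    ∀ (a : ℕ) (ha : a ≤ n) (_ : a ≤ k.val) (b : Fin n → (Fin m → ℤ)),
      LinearIndependent ℝ (⇑(intVecToEuclidean m).toAddMonoidHom ∘ b) →
      intSizeReduceFrom k a ha b = lllSizeReduceFrom (intVecToEuclidean m).toAddMonoidHom k a ha b
  | 0, _, _, _, _ => rfl
  | a + 1, ha, hak, b, hli => by
    have hlk : (⟨a, ha⟩ : Fin n) < k := Fin.mk_lt_of_lt_val hak
    rw [intSizeReduceFrom, lllSizeReduceFrom, intSizeReduce_eq b hli,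
      ← intSizeReduce_eq b hli]
    exact intSizeReduceFrom_eq k a _ (by omega) _ (linearIndependent_intSizeReduce b hli hlk)

/-- **The integer pass is LLL82's pass** on linearly independent integer vectors.
[cite: Cohen1993, Algorithm 2.6.7] [cite: LenstraLenstraLovasz1982, §1 Fig. 1] -/
theorem intStep_eq_lllStep (s : LLLState n (Fin m → ℤ))
    (hli : LinearIndependent ℝ (⇑(intVecToEuclidean m).toAddMonoidHom ∘ s.b)) :
    intStep s = lllStep (intVecToEuclidean m).toAddMonoidHom (3 / 4) s := by
  set φ := (intVecToEuclidean m).toAddMonoidHom with hφ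
  unfold intStep lllStep
  by_cases hk : 0 < s.k ∧ s.k < n
  · rw [dif_pos hk, dif_pos hk]
    set k : Fin n := ⟨s.k, hk.2⟩ with hkdef
    set j : Fin n := ⟨s.k - 1, by omega⟩ with hjdef
    have hjk : j < k := Fin.mk_lt_mk.2 (by omega)
    have hjk' : (k : ℕ) = j + 1 := by simp [hkdef, hjdef]; omega
    have hred : intSizeReduce s.b k j = lllSizeReduce φ s.b k j := intSizeReduce_eq s.b hli k j
    have hli₁ : LinearIndependent ℝ (⇑φ ∘ intSizeReduce s.b k j) :=
      linearIndependent_intSizeReduce s.b hli hjk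
    set b₁ := intSizeReduce s.b k j with hb₁
    set f₁ := ⇑φ ∘ b₁ with hf₁
    -- the Lovász test
    have hdk : (dRec b₁ s.k : ℝ) = gramDet f₁ k (le_of_lt k.isLt) := dRec_cast_eq_gramDet b₁ hli₁ _ _
    have hdk1 : (dRec b₁ (s.k + 1) : ℝ) = gramDet f₁ (k + 1) k.isLt := dRec_cast_eq_gramDet b₁ hli₁ _ _
    have hdj : (dRec b₁ (s.k - 1) : ℝ) = gramDet f₁ j (le_of_lt j.isLt) := dRec_cast_eq_gramDet b₁ hli₁ _ _
    have hlam : (uRec b₁ (s.k - 1) k j : ℝ) = gsNum f₁ k j := uRec_cast_eq_gsNum b₁ hli₁ k j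
    have htest : (3 * dRec b₁ s.k ^ 2 ≤
        4 * (dRec b₁ (s.k + 1) * dRec b₁ (s.k - 1) + uRec b₁ (s.k - 1) k j ^ 2)) ↔
        LovaszTestAt (3 / 4) f₁ j k := by
      rw [lovaszTestAt_iff_int f₁ j k hjk' (gramDet_pos hli₁ _ _) (gramSchmidt_ne_zero _ hli₁),
        ← hdk, ← hdk1, ← hdj, ← hlam]
      constructor
      · intro h; exact_mod_cast h
      · intro h; exact_mod_cast h
    by_cases ht : 3 * dRec b₁ s.k ^ 2 ≤
        4 * (dRec b₁ (s.k + 1) * dRec b₁ (s.k - 1) + uRec b₁ (s.k - 1) k j ^ 2)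
    · rw [if_pos ht, if_pos (by rw [← hred]; exact htest.1 ht)]
      congr 1
      rw [← hred]
      exact intSizeReduceFrom_eq k (s.k - 1) _ (by simp [hkdef]) b₁ hli₁
    · rw [if_neg ht, if_neg (by rw [← hred]; exact fun h => ht (htest.2 h)), ← hred]
  · rw [dif_neg hk, dif_neg hk]

/-- Hence all iterates agree: the integer algorithm started on a lattice basis runs through the
same states as LLL82 Fig. 1. [cite: Cohen1993, Algorithm 2.6.7] -/
theorem iterate_intStep_eq (b : Fin n → (Fin m → ℤ))
    (hli : LinearIndependent ℝ (⇑(intVecToEuclidean m).toAddMonoidHom ∘ b)) (t : ℕ) :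
    intStep^[t] (lllStart b) = (lllStep (intVecToEuclidean m).toAddMonoidHom (3 / 4))^[t] (lllStart b) := by
  induction t with
  | zero => rfl
  | succ t ih =>
    rw [iterate_succ_apply', iterate_succ_apply', ih]
    exact intStep_eq_lllStep _ (linearIndependent_iterate _ _ b hli t)

end IntStep

end Literature.Algebra.EuclideanLattices
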